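import Literature.MathematicalPhysics.QuantumFieldTheory.Balaban1983to89.B9Thm311PosOfPrincipalAtLettersY
import Literature.MathematicalPhysics.QuantumFieldTheory.Balaban1983to89.B9Eq335Plaquette

/-!
# `Balaban1983to89.B9Eq335PlaquetteAtLettersY` — T. Bałaban, *Propagators for lattice gauge theories in a background field*, Commun. Math. Phys. **99**
# (1985) 389–434 [Balaban1985BackgroundPropagators] (3.35) p. 396 with (3.69) p. 404: «THE ESTIMATES |Re U(∂p) − 1| ≤ …, |Im U(∂p)| ≤ … FOLLOW DIRECTLY FROM
# THE ASSUMPTIONS (3.35)» — AT def-Y's LETTERS (`Node00.OpsYDeltaA.holY ∕ reHolY ∕ imHolY`, the member's class `(bg9K … i).Reg335` of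
# `B9BackgroundsKLevelV1` over the cube class `cubeClass396 i`), per class cube; and ROW 17's ONE DISPLAYED CLAUSE reduced to LOCAL data
# (file 3 of this seat's (3.69) set; files 1–2 = `B9Ineq369CurvatureSmallAtLettersY`, `B9Thm311PosOfPrincipalAtLettersY`)

statement-level skeleton of published theorems with citation tags; proofs where landed; nothing here is a claim about the Yang–Mills mass gap

PDF held: `paper:balaban1985-cmp99-background-propagators` (journal page = PDF page + 388); pp. 396, 404 read by this seat (2026-08-27).

THE PRINT (verbatim).  p. 396, (3.35): *«for an arbitrary cube □ of the described above class, and for a configuration U there exists a gauge transformation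
u on □ such that U^u = e^{iηA}. and if the index of □ is j, then |A| < O(1)Mα₀(Lʲη)⁻¹, |∇^ηA| < O(1)Mα₀(Lʲη)⁻² on □»*.  p. 404, (3.69): *«|(Δ′(U′U)A′)(b)| ≤
O(1)(Mα₀ + α₁)(Lʲη)⁻²|A′|, b ∈ Ω_j (3.69) […] This bound follows from the estimates [|Re U(∂p) − 1| ≤ …, |Im U(∂p)| ≤ …] and the estimates follow directly
from the assumptions (3.35), (3.37).»*

WHY THIS FILE (cell context).  Files 1–2 proved, at def-Y's letters and in row 17's currency, that the curvature part of the Hessian is form-bounded by the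
plaquette defects `|Re U(∂p) − 1|` (relative to `‖D_UA‖²`) and `c_f²|Im U(∂p)|` (position-dependent weights), and reduced the N06 certificate's clause `hΔA`
(`PosDefTr 1 (deltaAY x.toKIdx (parSymY _) (parBY _) (GpY _ (parSymY _)) U)` for `U` in (3.35)) to a principal coercivity + plaquette smallness.  This file
supplies the plaquette smallness FROM def-Y's (3.35) DATUM, per class cube: in the cube gauge `U^u = e^{iηA}` the plaquette variable is CONJUGATE to
`e^{iηA_μ(x)}e^{iηA_ν(x+e_μ)}e^{−iηA_μ(x+e_ν)}e^{−iηA_ν(x)}` (plaquette variables are gauge-covariant), so `|U(∂p) − 1|` is read off the small potential by the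
tree's exponential bookkeeping `B9Eq335Plaquette.b7_52_of_b9_335`: `|U(∂p) − 1| ≤ 2C(1+C)e^{4C}·(η/(Lʲη))²`, `C = cMα₀` — and the scale-free product
`c_f²·|U(∂p) − 1| ≤ 2C(1+C)e^{4C}·(Lʲη)⁻²` is literally print's `O(1)Mα₀(Lʲη)⁻²` of (3.69).  It also records the LOCAL form of the reduction the position
dependence calls for: a uniform RELATIVE Jordan defect `ρ`, position-dependent curvature weights `w(p)` (`= O(1)Mα₀(Lʲη)⁻²` on the index-`j` cubes), and the
WEIGHTED principal coercivity `3Σ_p w(p)Σ_{b⊂∂p}HS(A(b)) < (1−ρ)‖D_UA‖² + ⟨D\*_UA, R(U)D\*_UA⟩ + ‖Q(U)A‖²_w` — the scale-by-scale comparison with the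
averaging masses `a_j(Lʲη)⁻²` of (3.16)∕(3.26) that Thm 3.3 ∕ [4] = [Balaban1984PropagatorsII] supplies (file 2's uniform-`δ` face is the single-scale case).
PRIOR ART DECLARED.  The exponential plaquette estimate is the tree's `B9Eq335Plaquette` (pub-balaban, B9 half of T-G19), used BY NAME at the fibre `M_N(ℂ)`;
the pub-balaban NE9 chain reads (3.35) at ITS letters (`B9Eq335SmallPlaquettesLocalData`, `B9Thm311SmallPlaquettes`); nothing of theirs is restated.

WHAT IS PROVED (sorry-free; 0 `def`; no inequality of the paper asserted as a hypothesis-free fact).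
* §1 (any complete normed ℂ-algebra `𝔸`): `shiftsV1_apply`, ★ `cfg_eq_of_gaugeTr` (`U^u(b) = e^{iηA(b)}` solved: `U(b) = u(b₋)⁻¹·e^{iηA(b)}·u(b₊)`),
  ★★ `holY_eq_conj` (`U(∂p) = u(x)⁻¹·(e^{iηA_μ(x)}e^{iηA_ν(x+e_μ)}e^{−iηA_μ(x+e_ν)}e^{−iηA_ν(x)})·u(x)` when the cube-gauge identity holds at `x, x+e_μ, x+e_ν`),
  `norm_conj_sub_one_le` (`|v⁻¹Wv − 1| ≤ |W − 1|` for a contraction pair `v, v⁻¹`), `covD_one_apply` (the flat `D¹` of (3.35) is the lattice difference).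
* §2 (`𝔸 = M_N(ℂ)`, operator norm, `N ≥ 1`): `norm_exp_plaquette_sub_one_le` (`b7_52_of_b9_335` at the fibre; the `ℚ`-structure `NormedSpace.exp` wants is
  `NormedAlgebra.restrictScalars ℚ ℂ`), ★★★ **`norm_holY_sub_one_le_of_reg335Cube`** (`Reg335Cube (shiftsV1 _) U η □ ξ C`, `0 < η ≤ ξ`, `0 ≤ C`, the plaquette's
  `x, x+e_μ, x+e_ν ∈ □` ⇒ `|U(∂p) − 1| ≤ 2C(1+C)e^{4C}(η/ξ)²`), `eta_pos`, `one_le_L`, ★★★ **`norm_holY_sub_one_le_of_reg335`** (def-Y's member class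
  `(bg9K (M_N(ℂ)) G i).Reg335 c α₀ U`, `(□, j) ∈ cubeClass396 i` ⇒ `|U(∂p) − 1| ≤ 2C(1+C)e^{4C}·L^{−2j}`, `C = c·M·α₀`), `cf_sq_mul_inv_pow_sq`
  (`c_f²·L^{−2j} = (Lʲη)⁻²`, `η = |c_f|⁻¹`).
* §3 ★★★ **`posDefTr_deltaAY_parSymY_of_local`** (`G ≤ U(N)`, `U` `G`-valued, `|Re U(∂p) − 1| ≤ ρ` for all `p`, `c_f²|Im U(∂p)| ≤ w(p)` for all `p`, and
  `3Σ_p w(p)Σ_{m<4}HS(A(b_m(p))) < (1−ρ)⟨D_UA, D_UA⟩₁ + ⟨D\*_UA, R(U)D\*_UA⟩₁ + ⟨Q(U)A, Q(U)A⟩_w` for `A ≠ 0` ⇒ `PosDefTr 1 (deltaAY i (parSymY i) (parBY i)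
  (GpY i (parSymY i)) U)` — via file 2's local bound `trIP_hessY_ge` and this lineage's `posDefTr_deltaAY_parSymY_of_forms`), ★★ `plaquette_data_of_reg335`
  (both (3.69) estimates per class cube from the member class: `|Re U(∂p) − 1| ≤ δ_j`, `c_f²|Im U(∂p)| ≤ 2C(1+C)e^{4C}(Lʲη)⁻²`, `δ_j = 2C(1+C)e^{4C}L^{−2j}`).
MODEL ∕ DECLARED READINGS.  (M1) as files 1–2: def-Y's letters at a k-level index `i`; the member's shifts `shiftsV1`, spacing `η = (kGeo i).eta = |c_f|⁻¹`,
`L = ℓ + 1`, `M = L·M_h`, cube class `cubeClass396 i`, class constant `C = c·M·α₀` (`B9BackgroundsKLevelV1`, the knit's `c = c35Y`); fibre `M_N(ℂ)` with Mathlib's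
`L²`-operator norm.  (M2) hypotheses DISPLAYED: membership of `U` in def-Y's (3.35) class; for a plaquette, membership of its three sites `x, x+e_μ, x+e_ν` in a
class cube (print: «b ∈ Ω_j», every bond∕plaquette of `Ω_j` lies in a class cube of index `j` or `j − 1` — that COVERAGE is a statement about the geometry
`cubeClass396 ∕ levV1 ∕ TDomains`, NOT proved here); in §3 the weighted principal coercivity.  (M3) the constant `2C(1+C)e^{4C}` (from `B9Eq335Plaquette`) is the
witness for print's `O(1)Mα₀`; `N ≥ 1` (`Nonempty (Fin N)`) for `NormOneClass`.  (M4) NOT HERE: the coverage lemma; the principal coercivity (Thm 3.3 ∕ [4]);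
(3.36)–(3.38); `Δ′(U′U) − Δ′(U)`.
HONEST SCOPE.  Bookkeeping over def-Y's definitions + the tree's exponential estimate; nothing of [B9] asserted; `hΔA` NOT discharged (after files 1–3 it rests on
the weighted principal coercivity = Thm 3.3 ∕ [4] content, and the coverage geometry); NOT a node discharge, NOT summit progress; count-neutral; nothing
continuum ∕ OS ∕ mass gap ∕ Clay.  Cell `pub-ymgap` (HUMAN RULING D-0062), Track A node N06 [B9], seat `pub-ymgap-dag-n06-j` (bundle F5 rows 15–17; harness re-seat
gen 11), 2026-08-27; dag-lead g9 DEDUP (INTENT-2).  NEW file importing file 2 and the tree's `B9Eq335Plaquette`; nothing landed is modified.  Net new unproved facts: 0.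
-/

noncomputable section

namespace Literature.MathematicalPhysics.QuantumFieldTheory.Balaban1983to89.B9Eq335PlaquetteAtLettersY

open Literature.MathematicalPhysics.QuantumFieldTheory.Balaban1983to89
open B9Thm311ReadingCoords B9Thm311AdjointAtLetters B9Thm311DeltaPrimeSymm B9Thm311DeltaPrimePos B9Thm311AdjointPairs B9Thm311Curv2Symm
  B9Thm311ProjectionR B9Ineq349SiteAdjoint B9Ineq369CurvatureSmallAtLettersY B9Thm311PosOfPrincipalAtLettersY Node00
open B6KLevelCensusIndexV1 B9BackgroundsKLevelV1 B6GlobalChartV1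
open scoped Matrix

/-! ## §1 The plaquette holonomy in a cube gauge: `U(∂p) = u(x)⁻¹·e^{iηA₁}e^{iηA₂}e^{−iηA₃}e^{−iηA₄}·u(x)` -/

section Gauge

variable {d ℓ : ℕ} {hd : 1 ≤ d + 1} {hL : Odd (ℓ + 1) ∧ 1 < ℓ + 1} {b₀ b₁ : ℝ}
variable (i : KIdx d ℓ hd hL b₀ b₁) {𝔸 : Type} [NormedRing 𝔸] [NormedAlgebra ℂ 𝔸] [CompleteSpace 𝔸]

/-- lattice translations of the fine torus commute. [folklore] -/
private theorem shift_comm {P : Params} (x : Site P 0) (μ ν : Fin P.d) : (x.shift μ).shift ν = (x.shift ν).shift μ := by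
  funext κ
  simp only [Site.shift, Function.update_apply]
  split_ifs with h1 h2 <;> subst_vars <;> simp_all

/-- the member's shift datum is `x ↦ x + e_μ`. [cite: Balaban1985BackgroundPropagators, (3.3) p.391, bookkeeping] -/
theorem shiftsV1_apply (P : Params) (μ : Fin P.d) (x : Site P 0) : shiftsV1 P μ x = x.shift μ := rfl

/-- the cube-gauge identity `U^u(b) = e^{iηA(b)}` at a bond source solved for the bond variable: `U(b) = u(b₋)⁻¹·e^{iηA(b)}·u(b₊)`.
[cite: Balaban1985BackgroundPropagators, (3.35) p.396 («U^u = e^{iηA}»), (3.28) p.395] -/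
theorem cfg_eq_of_gaugeTr {u : Site (PV d ℓ i.m i.K hd hL) 0 → 𝔸ˣ} {U : CfgY 𝔸 i} {η : ℝ}
    {A : Fin (PV d ℓ i.m i.K hd hL).d → Site (PV d ℓ i.m i.K hd hL) 0 → 𝔸} {κ : Fin (PV d ℓ i.m i.K hd hL).d} {z : Site (PV d ℓ i.m i.K hd hL) 0}
    (h : B9Eq3117Current.gaugeTr (shiftsV1 _) u U κ z = B9Eq39Adjoint.fluct η A κ z) :
    U κ z = (u z)⁻¹ * B9Eq39Adjoint.fluct η A κ z * u (z.shift κ) := by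
  have h' : u z * U κ z * (u (z.shift κ))⁻¹ = B9Eq39Adjoint.fluct η A κ z := h
  rw [← h']
  group

/-- ★ **THE PLAQUETTE HOLONOMY IN A CUBE GAUGE**: if the gauge identity `U^u = e^{iηA}` holds at the sources `x, x+e_μ, x+e_ν` of the four contour bonds of
`p = ⟨x, x+e_μ, x+e_μ+e_ν, x+e_ν⟩`, then `U(∂p) = u(x)⁻¹·(e^{iηA_μ(x)}e^{iηA_ν(x+e_μ)}e^{−iηA_μ(x+e_ν)}e^{−iηA_ν(x)})·u(x)` — the plaquette variable is
gauge-COVARIANT (conjugate), so its distance to `1` is read off the small potential. [cite: Balaban1985BackgroundPropagators, (3.35) p.396, (3.28) p.395, (3.1) p.390] -/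
theorem holY_eq_conj {u : Site (PV d ℓ i.m i.K hd hL) 0 → 𝔸ˣ} {U : CfgY 𝔸 i} {η : ℝ}
    {A : Fin (PV d ℓ i.m i.K hd hL).d → Site (PV d ℓ i.m i.K hd hL) 0 → 𝔸} (p : PlaqY i)
    (h1 : B9Eq3117Current.gaugeTr (shiftsV1 _) u U p.μ p.src = B9Eq39Adjoint.fluct η A p.μ p.src)
    (h2 : B9Eq3117Current.gaugeTr (shiftsV1 _) u U p.ν (p.src.shift p.μ) = B9Eq39Adjoint.fluct η A p.ν (p.src.shift p.μ))
    (h3 : B9Eq3117Current.gaugeTr (shiftsV1 _) u U p.μ (p.src.shift p.ν) = B9Eq39Adjoint.fluct η A p.μ (p.src.shift p.ν))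
    (h4 : B9Eq3117Current.gaugeTr (shiftsV1 _) u U p.ν p.src = B9Eq39Adjoint.fluct η A p.ν p.src) :
    holY i U p = (u p.src)⁻¹ *
      (B9Eq39Adjoint.fluct η A p.μ p.src * B9Eq39Adjoint.fluct η A p.ν (p.src.shift p.μ) * (B9Eq39Adjoint.fluct η A p.μ (p.src.shift p.ν))⁻¹ * (B9Eq39Adjoint.fluct η A p.ν p.src)⁻¹) * u p.src := by
  unfold holY
  rw [cfg_eq_of_gaugeTr i h1, cfg_eq_of_gaugeTr i h2, cfg_eq_of_gaugeTr i h3, cfg_eq_of_gaugeTr i h4, shift_comm p.src p.μ p.ν]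
  group

omit [NormedAlgebra ℂ 𝔸] [CompleteSpace 𝔸] in
/-- conjugation by a contraction pair does not increase the distance to `1`: `|v⁻¹Wv − 1| ≤ |W − 1|` for `|v|, |v⁻¹| ≤ 1`.
[cite: Balaban1985BackgroundPropagators, (3.35) p.396 (u with values in G), bookkeeping] -/
theorem norm_conj_sub_one_le {v : 𝔸ˣ} (hv : ‖(v : 𝔸)‖ ≤ 1 ∧ ‖((v⁻¹ : 𝔸ˣ) : 𝔸)‖ ≤ 1) (W : 𝔸ˣ) :
    ‖((v⁻¹ * W * v : 𝔸ˣ) : 𝔸) - 1‖ ≤ ‖(W : 𝔸) - 1‖ := by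
  have h : ((v⁻¹ * W * v : 𝔸ˣ) : 𝔸) - 1 = ((v⁻¹ : 𝔸ˣ) : 𝔸) * ((W : 𝔸) - 1) * (v : 𝔸) := by
    rw [Units.val_mul, Units.val_mul]
    have hvv : ((v⁻¹ : 𝔸ˣ) : 𝔸) * (v : 𝔸) = 1 := Units.inv_mul v
    calc ((v⁻¹ : 𝔸ˣ) : 𝔸) * (W : 𝔸) * (v : 𝔸) - 1 = ((v⁻¹ : 𝔸ˣ) : 𝔸) * (W : 𝔸) * (v : 𝔸) - ((v⁻¹ : 𝔸ˣ) : 𝔸) * (v : 𝔸) := by rw [hvv]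
      _ = _ := by noncomm_ring
  rw [h]
  calc ‖((v⁻¹ : 𝔸ˣ) : 𝔸) * ((W : 𝔸) - 1) * (v : 𝔸)‖ ≤ ‖((v⁻¹ : 𝔸ˣ) : 𝔸)‖ * ‖(W : 𝔸) - 1‖ * ‖(v : 𝔸)‖ :=
        (norm_mul_le _ _).trans (mul_le_mul_of_nonneg_right (norm_mul_le _ _) (norm_nonneg _))
    _ ≤ 1 * ‖(W : 𝔸) - 1‖ * 1 := by gcongr <;> [exact hv.2; exact hv.1]
    _ = ‖(W : 𝔸) - 1‖ := by ring

omit [NormedAlgebra ℂ 𝔸] [CompleteSpace 𝔸] in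
/-- the flat covariant derivative of the cube potential is the plain lattice difference: `(D¹_{1,κ}A_ν)(z) = A_ν(z+e_κ) − A_ν(z)`.
[cite: Balaban1985BackgroundPropagators, (3.3) p.390 (U = 1), (3.35) p.396 (∇^η)] -/
theorem covD_one_apply (A : Fin (PV d ℓ i.m i.K hd hL).d → Site (PV d ℓ i.m i.K hd hL) 0 → 𝔸) (κ ν : Fin (PV d ℓ i.m i.K hd hL).d)
    (z : Site (PV d ℓ i.m i.K hd hL) 0) :
    B9Eq39Adjoint.covD (shiftsV1 _) (fun _ _ => (1 : 𝔸ˣ)) κ (A ν) z = A ν (z.shift κ) - A ν z := by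
  simp [B9Eq39Adjoint.covD, shiftsV1_apply, B9Eq39Adjoint.R_one]

end Gauge

/-! ## §2 (3.35) on a cube ⇒ `|U(∂p) − 1| ≤ 2C(1+C)e^{4C}·(η/ξ)²` for the plaquettes of the cube (`𝔸 = M_N(ℂ)`, operator norm) -/

section Bound

open scoped Matrix.Norms.L2Operator

variable {d ℓ : ℕ} {hd : 1 ≤ d + 1} {hL : Odd (ℓ + 1) ∧ 1 < ℓ + 1} {b₀ b₁ : ℝ} {N : ℕ}
variable (i : KIdx d ℓ hd hL b₀ b₁)

/-- bond letters: `|iη•a| = η|a|`. [cite: Balaban1985BackgroundPropagators, (3.35) p.396, bookkeeping] -/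
private theorem norm_Ismul (a : Matrix (Fin N) (Fin N) ℂ) {η : ℝ} (hη : 0 ≤ η) : ‖((Complex.I * η : ℂ)) • a‖ = η * ‖a‖ := by
  rw [norm_smul, norm_mul, Complex.norm_I, one_mul, Complex.norm_real, Real.norm_of_nonneg hη]

/-- bond letters: `|(η:ℂ)⁻¹•v| = η⁻¹|v|`. [cite: Balaban1985BackgroundPropagators, (3.35) p.396, bookkeeping] -/
private theorem norm_inv_smul (v : Matrix (Fin N) (Fin N) ℂ) {η : ℝ} (hη : 0 < η) : ‖((η : ℂ))⁻¹ • v‖ = η⁻¹ * ‖v‖ := by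
  rw [norm_smul, norm_inv, Complex.norm_real, Real.norm_of_nonneg hη.le]

/-- the tree's exponential plaquette bookkeeping `B9Eq335Plaquette.b7_52_of_b9_335` AT THE FIBRE `M_N(ℂ)` (operator norm; the `ℚ`-algebra structure
`NormedSpace.exp` wants is the restriction of scalars from `ℂ`): `|X_b| ≤ Cξ`, `|X₁ − X₃|, |X₂ − X₄| ≤ Cξ²`, `0 ≤ ξ ≤ 1` ⇒
`|e^{X₁}e^{X₂}e^{−X₃}e^{−X₄} − 1| ≤ 2C(1+C)e^{4C}ξ²`. [cite: Balaban1985BackgroundPropagators, (3.35) p.396; Balaban1985Averaging, (52) p.26] -/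
theorem norm_exp_plaquette_sub_one_le [Nonempty (Fin N)] (X₁ X₂ X₃ X₄ : Matrix (Fin N) (Fin N) ℂ) {C ξ : ℝ} (hC : 0 ≤ C) (hξ0 : 0 ≤ ξ) (hξ1 : ξ ≤ 1)
    (h₁ : ‖X₁‖ ≤ C * ξ) (h₂ : ‖X₂‖ ≤ C * ξ) (h₃ : ‖X₃‖ ≤ C * ξ) (h₄ : ‖X₄‖ ≤ C * ξ)
    (h₁₃ : ‖X₁ - X₃‖ ≤ C * ξ ^ 2) (h₂₄ : ‖X₂ - X₄‖ ≤ C * ξ ^ 2) :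
    ‖NormedSpace.exp X₁ * NormedSpace.exp X₂ * NormedSpace.exp (-X₃) * NormedSpace.exp (-X₄) - 1‖
      ≤ (2 * C * (1 + C) * Real.exp (4 * C)) * ξ ^ 2 := by
  letI : NormedAlgebra ℚ (Matrix (Fin N) (Fin N) ℂ) := NormedAlgebra.restrictScalars ℚ ℂ _
  exact B9Eq335Plaquette.b7_52_of_b9_335 X₁ X₂ X₃ X₄ hC hξ0 hξ1 h₁ h₂ h₃ h₄ h₁₃ h₂₄

/-- ★★ **(3.35) ON A CUBE ⇒ THE PLAQUETTE ESTIMATE OF (3.69)**: if `U^u = e^{iηA}` on a cube with `|A| < Cξ⁻¹`, `|∇^ηA| < Cξ⁻²` there (def-Y's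
`Reg335Cube` datum for the member's shifts), `0 < η ≤ ξ`, `0 ≤ C`, then every plaquette whose corner `x` and neighbours `x+e_μ`, `x+e_ν` lie in the cube has
`|U(∂p) − 1| ≤ 2C(1+C)e^{4C}·(η/ξ)²` (operator norm; `N ≥ 1`).  Print: «the estimates [|Re U(∂p) − 1| ≤ …, |Im U(∂p)| ≤ …] follow directly from the assumptions
(3.35)»; the exponential bookkeeping is the tree's `B9Eq335Plaquette.b7_52_of_b9_335`. [cite: Balaban1985BackgroundPropagators, (3.35) p.396, (3.69) p.404] -/
theorem norm_holY_sub_one_le_of_reg335Cube [Nonempty (Fin N)] (U : CfgY (Matrix (Fin N) (Fin N) ℂ) i) {cube : Set (Site (PV d ℓ i.m i.K hd hL) 0)}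
    {η ξ C : ℝ} (hη : 0 < η) (hηξ : η ≤ ξ) (hC : 0 ≤ C)
    (h : B9Eq335RegularityClasses.Reg335Cube (shiftsV1 _) U η cube ξ C) (p : PlaqY i)
    (hx : p.src ∈ cube) (hxμ : p.src.shift p.μ ∈ cube) (hxν : p.src.shift p.ν ∈ cube) :
    ‖((holY i U p : (Matrix (Fin N) (Fin N) ℂ)ˣ) : Matrix (Fin N) (Fin N) ℂ) - 1‖ ≤ 2 * C * (1 + C) * Real.exp (4 * C) * (η / ξ) ^ 2 := by
  obtain ⟨u, A, hu, hg, hA, hD⟩ := h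
  have hξ : 0 < ξ := lt_of_lt_of_le hη hηξ
  have hr0 : 0 ≤ η / ξ := div_nonneg hη.le hξ.le
  have hr1 : η / ξ ≤ 1 := (div_le_one hξ).2 hηξ
  -- the four sizes `|X_b| ≤ C(η/ξ)`
  have size : ∀ (κ : Fin (PV d ℓ i.m i.K hd hL).d) (z : Site (PV d ℓ i.m i.K hd hL) 0), z ∈ cube →
      ‖((Complex.I * η : ℂ)) • A κ z‖ ≤ C * (η / ξ) := by
    intro κ z hz
    rw [norm_Ismul _ hη.le, show C * (η / ξ) = η * (C * ξ⁻¹) by ring]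
    exact mul_le_mul_of_nonneg_left (hA κ z hz).le hη.le
  -- the two differences `|X₁ − X₃|, |X₂ − X₄| ≤ C(η/ξ)²`
  have diff : ∀ (κ ν : Fin (PV d ℓ i.m i.K hd hL).d) (z : Site (PV d ℓ i.m i.K hd hL) 0), z ∈ cube →
      ‖((Complex.I * η : ℂ)) • A ν z - ((Complex.I * η : ℂ)) • A ν (z.shift κ)‖ ≤ C * (η / ξ) ^ 2 := by
    intro κ ν z hz
    have h1 := (hD κ ν z hz).le
    rw [covD_one_apply, norm_inv_smul _ hη] at h1
    rw [← smul_sub, norm_Ismul _ hη.le, norm_sub_rev]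
    have h2 : ‖A ν (z.shift κ) - A ν z‖ ≤ η * (C * (ξ ^ 2)⁻¹) := by
      rwa [inv_mul_le_iff₀ hη] at h1
    calc η * ‖A ν (z.shift κ) - A ν z‖ ≤ η * (η * (C * (ξ ^ 2)⁻¹)) := mul_le_mul_of_nonneg_left h2 hη.le
      _ = C * (η / ξ) ^ 2 := by field_simp
  have diff' : ∀ (κ ν : Fin (PV d ℓ i.m i.K hd hL).d) (z : Site (PV d ℓ i.m i.K hd hL) 0), z ∈ cube →
      ‖((Complex.I * η : ℂ)) • A ν (z.shift κ) - ((Complex.I * η : ℂ)) • A ν z‖ ≤ C * (η / ξ) ^ 2 := fun κ ν z hz => by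
    rw [norm_sub_rev]; exact diff κ ν z hz
  -- the product of the four fluctuation units is `e^{X₁}e^{X₂}e^{−X₃}e^{−X₄}`
  have e : (((B9Eq39Adjoint.fluct η A p.μ p.src * B9Eq39Adjoint.fluct η A p.ν (p.src.shift p.μ) *
      (B9Eq39Adjoint.fluct η A p.μ (p.src.shift p.ν))⁻¹ * (B9Eq39Adjoint.fluct η A p.ν p.src)⁻¹ : (Matrix (Fin N) (Fin N) ℂ)ˣ)) : Matrix (Fin N) (Fin N) ℂ) =
      NormedSpace.exp (((Complex.I * η : ℂ)) • A p.μ p.src) * NormedSpace.exp (((Complex.I * η : ℂ)) • A p.ν (p.src.shift p.μ)) *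
        NormedSpace.exp (-(((Complex.I * η : ℂ)) • A p.μ (p.src.shift p.ν))) * NormedSpace.exp (-(((Complex.I * η : ℂ)) • A p.ν p.src)) := by
    simp [B9Eq39Adjoint.fluct, Beta.TransportVertices.holonomy]
  have step2 := norm_exp_plaquette_sub_one_le (((Complex.I * η : ℂ)) • A p.μ p.src) (((Complex.I * η : ℂ)) • A p.ν (p.src.shift p.μ))
    (((Complex.I * η : ℂ)) • A p.μ (p.src.shift p.ν)) (((Complex.I * η : ℂ)) • A p.ν p.src) hC hr0 hr1
    (size p.μ p.src hx) (size p.ν _ hxμ) (size p.μ _ hxν) (size p.ν p.src hx) (diff p.ν p.μ p.src hx) (diff' p.μ p.ν p.src hx)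
  rw [← e] at step2
  have hhol := holY_eq_conj i p (hg _ _ hx) (hg _ _ hxμ) (hg _ _ hxν) (hg _ _ hx)
  have step1 := norm_conj_sub_one_le (hu _ hx) (B9Eq39Adjoint.fluct η A p.μ p.src * B9Eq39Adjoint.fluct η A p.ν (p.src.shift p.μ) *
      (B9Eq39Adjoint.fluct η A p.μ (p.src.shift p.ν))⁻¹ * (B9Eq39Adjoint.fluct η A p.ν p.src)⁻¹)
  rw [← hhol] at step1
  exact step1.trans step2

/-- the member's spacing `η = |c_f|⁻¹` is positive. [cite: Balaban1985BackgroundPropagators, p.396 (the lattice T_η), bookkeeping] -/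
theorem eta_pos : 0 < (kGeo i).eta := by
  show 0 < |i.cf|⁻¹
  exact inv_pos.2 (abs_pos.2 i.hcf)

/-- the member's `L = ℓ + 1 ≥ 1`. [cite: Balaban1985BackgroundPropagators, p.396, bookkeeping] -/
theorem one_le_L : (1 : ℝ) ≤ (kGeo i).L := by
  show (1 : ℝ) ≤ ((ℓ + 1 : ℕ) : ℝ)
  exact_mod_cast Nat.succ_le_succ (Nat.zero_le ℓ)

/-- ★★★ **(3.35) AT A MEMBER ⇒ THE PLAQUETTE ESTIMATE, per class cube**: for `U` in def-Y's class `(bg9K … i).Reg335 c α₀` and a class cube `(□, j)`, every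
plaquette with `x, x+e_μ, x+e_ν ∈ □` has `|U(∂p) − 1| ≤ 2C(1+C)e^{4C}·L^{−2j}`, `C = c·M·α₀` — i.e. `c_f²·|U(∂p) − 1| ≤ 2C(1+C)e^{4C}·(Lʲη)⁻²`, print's
`O(1)Mα₀(Lʲη)⁻²` of (3.69). [cite: Balaban1985BackgroundPropagators, (3.35) p.396, (3.69) p.404] -/
theorem norm_holY_sub_one_le_of_reg335 [Nonempty (Fin N)] {G : Subgroup (Matrix (Fin N) (Fin N) ℂ)ˣ} (U : CfgY (Matrix (Fin N) (Fin N) ℂ) i)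
    {c α₀ : ℝ} (hC : 0 ≤ c * (kGeo i).M * α₀) (h : (bg9K (Matrix (Fin N) (Fin N) ℂ) G i).Reg335 c α₀ U)
    {q : Set (Site (PV d ℓ i.m i.K hd hL) 0) × ℕ} (hq : q ∈ cubeClass396 i) (p : PlaqY i)
    (hx : p.src ∈ q.1) (hxμ : p.src.shift p.μ ∈ q.1) (hxν : p.src.shift p.ν ∈ q.1) :
    ‖((holY i U p : (Matrix (Fin N) (Fin N) ℂ)ˣ) : Matrix (Fin N) (Fin N) ℂ) - 1‖ ≤
      2 * (c * (kGeo i).M * α₀) * (1 + c * (kGeo i).M * α₀) * Real.exp (4 * (c * (kGeo i).M * α₀)) * (((kGeo i).L ^ q.2)⁻¹) ^ 2 := by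
  have hcube := h.2 q hq
  have hη := eta_pos i
  have hLj : (1 : ℝ) ≤ (kGeo i).L ^ q.2 := one_le_pow₀ (one_le_L i)
  have hηξ : (kGeo i).eta ≤ LatticeNorms.scaleLen (kGeo i).L (kGeo i).eta q.2 := by
    unfold LatticeNorms.scaleLen; nlinarith
  have key := norm_holY_sub_one_le_of_reg335Cube i U hη hηξ hC hcube p hx hxμ hxν
  have hratio : (kGeo i).eta / LatticeNorms.scaleLen (kGeo i).L (kGeo i).eta q.2 = ((kGeo i).L ^ q.2)⁻¹ := by
    have hη0 : (kGeo i).eta ≠ 0 := hη.ne'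
    unfold LatticeNorms.scaleLen
    rw [div_mul_eq_div_div_swap, div_self hη0, one_div]
  rwa [hratio] at key

/-- the scale-free product behind (3.69): `c_f²·L^{−2j} = (Lʲη)⁻²` for the member (`η = |c_f|⁻¹`). [cite: Balaban1985BackgroundPropagators, (3.69) p.404 ((Lʲη)⁻²), bookkeeping] -/
theorem cf_sq_mul_inv_pow_sq (j : ℕ) : i.cf ^ 2 * (((kGeo i).L ^ j)⁻¹) ^ 2 = ((LatticeNorms.scaleLen (kGeo i).L (kGeo i).eta j)⁻¹) ^ 2 := by
  have hcf : i.cf ≠ 0 := i.hcf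
  show i.cf ^ 2 * ((((ℓ + 1 : ℕ) : ℝ) ^ j)⁻¹) ^ 2 = ((((ℓ + 1 : ℕ) : ℝ) ^ j * |i.cf|⁻¹)⁻¹) ^ 2
  rw [mul_inv, inv_inv, mul_pow, sq_abs]
  ring

end Bound

/-! ## §3 Row 17's clause from the LOCAL data: position-dependent curvature weights against a weighted principal coercivity -/

section Local

open scoped Matrix.Norms.L2Operator

variable {d ℓ : ℕ} {hd : 1 ≤ d + 1} {hL : Odd (ℓ + 1) ∧ 1 < ℓ + 1} {b₀ b₁ : ℝ} {N : ℕ}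
variable (i : KIdx d ℓ hd hL b₀ b₁) {U : CfgY (Matrix (Fin N) (Fin N) ℂ) i}

/-- ★★★ **ROW 17's CLAUSE FROM LOCAL DATA**: at a `G`-valued background (`G ≤ U(N)`) with a UNIFORM relative Jordan defect `|Re U(∂p) − 1| ≤ ρ` and LOCAL
curvature weights `c_f²|Im U(∂p)| ≤ w(p)` (print: `w(p) = O(1)Mα₀(Lʲη)⁻²` on `Ω_j`, §2), def-Y's `Δ_a(U)` is positive definite as soon as the principal gauge-fixed
form beats the weighted curvature: `3·Σ_p w(p)·Σ_{b⊂∂p}HS(A(b)) < (1−ρ)⟨D_UA, D_UA⟩₁ + ⟨D\*_UA, R(U)D\*_UA⟩₁ + ⟨Q(U)A, Q(U)A⟩_w` for `A ≠ 0` — the scale-by-scale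
comparison of (3.69) with the averaging masses `a_j(Lʲη)⁻²` of (3.16)∕(3.26) (Thm 3.3 ∕ [4] content, displayed). [cite: Balaban1985BackgroundPropagators, Thm 3.11 p.416, (3.26) p.395, (3.69) p.404, (3.16) p.393] -/
theorem posDefTr_deltaAY_parSymY_of_local {G : Subgroup (Matrix (Fin N) (Fin N) ℂ)ˣ}
    (hG : G ≤ B7Prop2Explicit.unitaryUnits (Matrix (Fin N) (Fin N) ℂ)) (hU : ∀ μ x, U μ x ∈ G) {ρ : ℝ} (w : PlaqY i → ℝ)
    (hρ : ∀ p : PlaqY i, ‖reHolY i U p - 1‖ ≤ ρ) (hw : ∀ p : PlaqY i, i.cf ^ 2 * ‖imHolY i U p‖ ≤ w p)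
    (hcoer : ∀ A : FBondY i → Matrix (Fin N) (Fin N) ℂ, A ≠ 0 →
      3 * ∑ p : PlaqY i, w p * ∑ m : Fin 4, ∑ a, ∑ b, ‖A (edgeY i p m) a b‖ ^ 2 <
        (1 - ρ) * trIP (fun _ => (1 : ℝ)) (curlY i U A) (curlY i U A)
        + trIP (fun _ => (1 : ℝ)) (divY i U A) (RY i (parSymY i) (GpY i (parSymY i)) U (divY i U A))
        + trIP i.w (QY i (parBY i) U A) (QY i (parBY i) U A)) :
    PosDefTr (fun _ => (1 : ℝ)) (deltaAY i (parSymY i) (parBY i) (GpY i (parSymY i)) U) := by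
  have hU' : ∀ μ x, ((U μ x : (Matrix (Fin N) (Fin N) ℂ)ˣ) : Matrix (Fin N) (Fin N) ℂ) ∈ unitary (Matrix (Fin N) (Fin N) ℂ) := fun μ x => hG (hU μ x)
  refine posDefTr_deltaAY_parSymY_of_forms i hG hU fun A hA => ?_
  have h0 := trIP_hessY_ge i hU' A
  have hJ : (1 - ρ) * trIP (fun _ => (1 : ℝ)) (curlY i U A) (curlY i U A) ≤
      ∑ p : PlaqY i, (1 - ‖reHolY i U p - 1‖) * ∑ a, ∑ b, ‖curlY i U A p a b‖ ^ 2 := by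
    rw [trIP_one_self_eq, Finset.mul_sum]
    exact Finset.sum_le_sum fun p _ => mul_le_mul_of_nonneg_right (by linarith [hρ p]) (hs_nonneg _)
  have hC : ∑ p : PlaqY i, i.cf ^ 2 * ‖imHolY i U p‖ * ∑ m : Fin 4, ∑ a, ∑ b, ‖A (edgeY i p m) a b‖ ^ 2 ≤
      ∑ p : PlaqY i, w p * ∑ m : Fin 4, ∑ a, ∑ b, ‖A (edgeY i p m) a b‖ ^ 2 :=
    Finset.sum_le_sum fun p _ => mul_le_mul_of_nonneg_right (hw p) (Finset.sum_nonneg fun _ _ => hs_nonneg _)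
  have h2 := hcoer A hA
  linarith

/-- ★★ **THE LOCAL DATA FROM (3.35), packaged per class cube** (`G ≤ U(N)`, `N ≥ 1`): for `U` in def-Y's class `(bg9K … i).Reg335 c α₀` and a class cube
`(□, j)`, every plaquette with `x, x+e_μ, x+e_ν ∈ □` has BOTH (3.69) estimates with `δ_j = 2C(1+C)e^{4C}L^{−2j}`, `C = cMα₀`:
`|Re U(∂p) − 1| ≤ δ_j` and `c_f²|Im U(∂p)| ≤ c_f²δ_j = 2C(1+C)e^{4C}(Lʲη)⁻²`. [cite: Balaban1985BackgroundPropagators, (3.35) p.396, (3.69) p.404] -/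
theorem plaquette_data_of_reg335 [Nonempty (Fin N)] {G : Subgroup (Matrix (Fin N) (Fin N) ℂ)ˣ}
    (hG : G ≤ B7Prop2Explicit.unitaryUnits (Matrix (Fin N) (Fin N) ℂ)) (U : CfgY (Matrix (Fin N) (Fin N) ℂ) i)
    {c α₀ : ℝ} (hC : 0 ≤ c * (kGeo i).M * α₀) (h : (bg9K (Matrix (Fin N) (Fin N) ℂ) G i).Reg335 c α₀ U)
    {q : Set (Site (PV d ℓ i.m i.K hd hL) 0) × ℕ} (hq : q ∈ cubeClass396 i) (p : PlaqY i)
    (hx : p.src ∈ q.1) (hxμ : p.src.shift p.μ ∈ q.1) (hxν : p.src.shift p.ν ∈ q.1) :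
    ‖reHolY i U p - 1‖ ≤ 2 * (c * (kGeo i).M * α₀) * (1 + c * (kGeo i).M * α₀) * Real.exp (4 * (c * (kGeo i).M * α₀)) * (((kGeo i).L ^ q.2)⁻¹) ^ 2 ∧
      i.cf ^ 2 * ‖imHolY i U p‖ ≤
        2 * (c * (kGeo i).M * α₀) * (1 + c * (kGeo i).M * α₀) * Real.exp (4 * (c * (kGeo i).M * α₀)) * ((LatticeNorms.scaleLen (kGeo i).L (kGeo i).eta q.2)⁻¹) ^ 2 := by
  have hU' : ∀ μ x, ((U μ x : (Matrix (Fin N) (Fin N) ℂ)ˣ) : Matrix (Fin N) (Fin N) ℂ) ∈ unitary (Matrix (Fin N) (Fin N) ℂ) := fun μ x => hG (h.1 μ x)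
  have key := norm_holY_sub_one_le_of_reg335 i U hC h hq p hx hxμ hxν
  refine ⟨norm_reHolY_sub_one_le i U hU' key, ?_⟩
  have him := norm_imHolY_le i U hU' key
  rw [← cf_sq_mul_inv_pow_sq i q.2]
  calc i.cf ^ 2 * ‖imHolY i U p‖ ≤ i.cf ^ 2 * (2 * (c * (kGeo i).M * α₀) * (1 + c * (kGeo i).M * α₀) * Real.exp (4 * (c * (kGeo i).M * α₀)) *
        (((kGeo i).L ^ q.2)⁻¹) ^ 2) := mul_le_mul_of_nonneg_left him (sq_nonneg _)
    _ = _ := by ring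

end Local

end Literature.MathematicalPhysics.QuantumFieldTheory.Balaban1983to89.B9Eq335PlaquetteAtLettersY
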